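import Summits.BirchSwinnertonDyer.BirchSwinnertonDyer.Theorems.ResidualThetaTransportAtTwoThetaLayerLambdaCongruenceAtTwoHeckeAdjointManinSide
import HarnessLib

/-!
# Crux `ThetaLayerLambdaCongruenceAtTwo` (stmt-BirchSwinnertonDyer-20688, route ResidualThetaTransportAtTwo), line
# `birth` v14 — SD floor, kernel road, Hecke clause of IP, brick HA8-M' «MANIN SIDE»: for a pairing `B` with w2's crossing formula and an
# upper-triangular Hecke cocycle `α_i γ' = δ_i α_{σ i}` acting on the MANIN slot, `2·Σ_i B({∞,γ∞}, {∞,δ_i∞})` is the flag sum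
# `Σ_{g∈L(γ')} Σ_i Σ'_{u∈Γ₀(N)} [F(g⁻¹·adj(α_i)·u⁻¹·γ) − F(g⁻¹·adj(α_i)·u⁻¹)]` (width seat bsd-wall-rtt-p3-w3 g11;
# `--supports stmt-BirchSwinnertonDyer-20688 --as helper`; closes nothing)

HONEST FRAMING. THEOREMS only, about an arbitrary bi-additive `B` satisfying w2's crossing formula (hypothesis `hB` verbatim from
`exists_perfect_crossingPairing_hecke`); no definition; nothing about any curve or form is asserted; BSD is not proved by any of this.

WHAT (memo `Cruxes/ThetaLayerLambdaCongruenceAtTwo/Lines/birth-sd2-hecke-adjoint.md`, step (D), Manin side). `manin_side_flag_sum` assembles: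
Manin chains of the `δ_i` by concatenated re-expansions (`maninChain_of_reexpansions`, HA7'), the block identity `manin_block` (HA8-M), and the
outer edge reversal `adj(α_i g S) = S⁻¹ g⁻¹ adj(α_i)` with `F(S⁻¹Z) = 1 − F(Z)` (`flagSide_Sinv_mul`). Together with `dual_side_flag_sum`
(HA6 file) and the double-coset sweep (lead's HA8b) this gives the transpose identity `B(T♯ x, y) = B(x, T y)`.

References: [Merel1995Homologie] §2.1–2.3; [Manin1972] §1.5–1.7; [Shimura1971] §3.1.
-/

set_option autoImplicit false

noncomputable section

-- justification: the `Summit.BirchSwinnertonDyer.BirchSwinnertonDyer.…` path repeats a component (route-file convention)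
set_option linter.dupNamespace false

open scoped Classical MatrixGroups

open CongruenceSubgroup Matrix.SpecialLinearGroup ModularGroup
open Literature.NumberTheory.EllipticCurves.ModularForms

namespace Summit.BirchSwinnertonDyer.BirchSwinnertonDyer.Theorems.ThetaLayerLambdaCongruenceAtTwo

section ManinSupport

variable {N : ℕ}

/-- **Finite support of the Manin-side block summand** (same data as `manin_block`): only finitely many `u ∈ Γ₀(N)` contribute to
`F(adj(C)·u⁻¹·γ) − F(adj(C)·u⁻¹)` (= block total − κ-bracket, both finitely supported). [cite: Merel1995Homologie, §2.1] -/
theorem manin_block_support (γ : Gamma0 N) (D : List SL(2, ℤ))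
    (hD : ∀ {A : Type} [AddCommGroup A] (G : SL(2, ℤ) → A),
      (∀ x, G (x * (S * T⁻¹)) = G x) → (∀ x, G (-x) = G x) → (D.map fun h ↦ G h - G (h * S)).sum = G (γ : SL(2, ℤ)) - G 1)
    (g₀ : SL(2, ℤ)) (u v w d : ℤ) (m : ℕ) (x y : ℕ → ℤ) (P : List SL(2, ℤ))
    (hu : 0 < u) (hd : 0 < d) (hm : 1 ≤ m) (hx0 : x 0 = 1) (hy0 : y 0 = 0)
    (hypos : ∀ j, 1 ≤ j → j ≤ m → 0 < y j) (hdet : ∀ j, j < m → x j * y (j + 1) - x (j + 1) * y j = 1)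
    (hvd : v = d * x m) (hwd : w = d * y m) (hlen : P.length = m)
    (hget : ∀ (j : ℕ) (hj : j < P.length), ((P[j] : SL(2, ℤ)) : Matrix (Fin 2) (Fin 2) ℤ) = !![x j, x (j + 1); y j, y (j + 1)]) :
    (Function.support fun uu : Gamma0 N ↦
        ((if (0 < (((g₀ : Matrix (Fin 2) (Fin 2) ℤ) * !![u, v; 0, w]).adjugate * (((uu⁻¹ : Gamma0 N) : SL(2, ℤ)) : Matrix (Fin 2) (Fin 2) ℤ) * ((γ : SL(2, ℤ)) : Matrix (Fin 2) (Fin 2) ℤ)) 0 0 * (((g₀ : Matrix (Fin 2) (Fin 2) ℤ) * !![u, v; 0, w]).adjugate * (((uu⁻¹ : Gamma0 N) : SL(2, ℤ)) : Matrix (Fin 2) (Fin 2) ℤ) * ((γ : SL(2, ℤ)) : Matrix (Fin 2) (Fin 2) ℤ)) 1 0 ∨ ((((g₀ : Matrix (Fin 2) (Fin 2) ℤ) * !![u, v; 0, w]).adjugate * (((uu⁻¹ : Gamma0 N) : SL(2, ℤ)) : Matrix (Fin 2) (Fin 2) ℤ) * ((γ : SL(2, ℤ)) : Matrix (Fin 2)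 (Fin 2) ℤ)) 0 0 * (((g₀ : Matrix (Fin 2) (Fin 2) ℤ) * !![u, v; 0, w]).adjugate * (((uu⁻¹ : Gamma0 N) : SL(2, ℤ)) : Matrix (Fin 2) (Fin 2) ℤ) * ((γ : SL(2, ℤ)) : Matrix (Fin 2) (Fin 2) ℤ)) 1 0 = 0 ∧ (0 < ((((g₀ : Matrix (Fin 2) (Fin 2) ℤ) * !![u, v; 0, w]).adjugate * (((uu⁻¹ : Gamma0 N) : SL(2, ℤ)) : Matrix (Fin 2) (Fin 2) ℤ) * ((γ : SL(2, ℤ)) : Matrix (Fin 2) (Fin 2) ℤ)) 0 0 + 2 * (((g₀ : Matrix (Fin 2) (Fin 2) ℤ) * !![u, v; 0, w]).adjugate * (((uu⁻¹ : Gamma0 N) : SL(2, ℤ)) : Matrix (Fin 2) (Fin 2) ℤ) * ((γ : SL(2, ℤ)) : Matrix (Fin 2) (Fin 2) ℤ)) 0 1) * ((((g₀ : Matrix (Fin 2) (Fin 2) ℤ) * !![u, v; 0, w]).adjugate * (((uu⁻¹ : Gamma0 N) : SL(2, ℤ)) : Matrix (Fin 2) (Fin 2) ℤ) * ((γ : SL(2,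 ℤ)) : Matrix (Fin 2) (Fin 2) ℤ)) 1 0 + 2 * (((g₀ : Matrix (Fin 2) (Fin 2) ℤ) * !![u, v; 0, w]).adjugate * (((uu⁻¹ : Gamma0 N) : SL(2, ℤ)) : Matrix (Fin 2) (Fin 2) ℤ) * ((γ : SL(2, ℤ)) : Matrix (Fin 2) (Fin 2) ℤ)) 1 1) ∨
          (((((g₀ : Matrix (Fin 2) (Fin 2) ℤ) * !![u, v; 0, w]).adjugate * (((uu⁻¹ : Gamma0 N) : SL(2, ℤ)) : Matrix (Fin 2) (Fin 2) ℤ) * ((γ : SL(2, ℤ)) : Matrix (Fin 2) (Fin 2) ℤ)) 0 0 + 2 * (((g₀ : Matrix (Fin 2) (Fin 2) ℤ) * !![u, v; 0, w]).adjugate * (((uu⁻¹ : Gamma0 N) : SL(2, ℤ)) : Matrix (Fin 2) (Fin 2) ℤ) * ((γ : SL(2, ℤ)) : Matrix (Fin 2) (Fin 2) ℤ)) 0 1) * ((((g₀ : Matrix (Fin 2) (Fin 2) ℤ) * !![u, v; 0, w]).adjugate * (((uu⁻¹ : Gamma0 N) : SL(2, ℤ)) : Matrix (Fin 2) (Fin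 2) ℤ) * ((γ : SL(2, ℤ)) : Matrix (Fin 2) (Fin 2) ℤ)) 1 0 + 2 * (((g₀ : Matrix (Fin 2) (Fin 2) ℤ) * !![u, v; 0, w]).adjugate * (((uu⁻¹ : Gamma0 N) : SL(2, ℤ)) : Matrix (Fin 2) (Fin 2) ℤ) * ((γ : SL(2, ℤ)) : Matrix (Fin 2) (Fin 2) ℤ)) 1 1) = 0 ∧ 0 < (((g₀ : Matrix (Fin 2) (Fin 2) ℤ) * !![u, v; 0, w]).adjugate * (((uu⁻¹ : Gamma0 N) : SL(2, ℤ)) : Matrix (Fin 2) (Fin 2) ℤ) * ((γ : SL(2, ℤ)) : Matrix (Fin 2) (Fin 2) ℤ)) 0 0 * (((g₀ : Matrix (Fin 2) (Fin 2) ℤ) * !![u, v; 0, w]).adjugate * (((uu⁻¹ : Gamma0 N) : SL(2, ℤ)) : Matrix (Fin 2) (Fin 2) ℤ) * ((γ : SL(2, ℤ)) : Matrix (Fin 2) (Fin 2) ℤ)) 1 1 + (((g₀ : Matrix (Fin 2) (Fin 2) ℤ) * !![u, v; 0, w]).adjugate * (((uu⁻¹ : Gamma0 N) : SL(2, ℤ))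 : Matrix (Fin 2) (Fin 2) ℤ) * ((γ : SL(2, ℤ)) : Matrix (Fin 2) (Fin 2) ℤ)) 0 1 * (((g₀ : Matrix (Fin 2) (Fin 2) ℤ) * !![u, v; 0, w]).adjugate * (((uu⁻¹ : Gamma0 N) : SL(2, ℤ)) : Matrix (Fin 2) (Fin 2) ℤ) * ((γ : SL(2, ℤ)) : Matrix (Fin 2) (Fin 2) ℤ)) 1 0)))) then (1 : ℤ) else 0) -
         (if (0 < (((g₀ : Matrix (Fin 2) (Fin 2) ℤ) * !![u, v; 0, w]).adjugate * (((uu⁻¹ : Gamma0 N) : SL(2, ℤ)) : Matrix (Fin 2) (Fin 2) ℤ)) 0 0 * (((g₀ : Matrix (Fin 2) (Fin 2) ℤ) * !![u, v; 0, w]).adjugate * (((uu⁻¹ : Gamma0 N) : SL(2, ℤ)) : Matrix (Fin 2) (Fin 2) ℤ)) 1 0 ∨ ((((g₀ : Matrix (Fin 2) (Fin 2) ℤ) * !![u, v; 0, w]).adjugate * (((uu⁻¹ : Gamma0 N) : SL(2, ℤ)) : Matrix (Fin 2) (Fin 2) ℤ)) 0 0 * (((g₀ : Matrix (Fin 2)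 (Fin 2) ℤ) * !![u, v; 0, w]).adjugate * (((uu⁻¹ : Gamma0 N) : SL(2, ℤ)) : Matrix (Fin 2) (Fin 2) ℤ)) 1 0 = 0 ∧ (0 < ((((g₀ : Matrix (Fin 2) (Fin 2) ℤ) * !![u, v; 0, w]).adjugate * (((uu⁻¹ : Gamma0 N) : SL(2, ℤ)) : Matrix (Fin 2) (Fin 2) ℤ)) 0 0 + 2 * (((g₀ : Matrix (Fin 2) (Fin 2) ℤ) * !![u, v; 0, w]).adjugate * (((uu⁻¹ : Gamma0 N) : SL(2, ℤ)) : Matrix (Fin 2) (Fin 2) ℤ)) 0 1) * ((((g₀ : Matrix (Fin 2) (Fin 2) ℤ) * !![u, v; 0, w]).adjugate * (((uu⁻¹ : Gamma0 N) : SL(2, ℤ)) : Matrix (Fin 2) (Fin 2) ℤ)) 1 0 + 2 * (((g₀ : Matrix (Fin 2) (Fin 2) ℤ) * !![u, v; 0, w]).adjugate * (((uu⁻¹ : Gamma0 N) : SL(2, ℤ)) : Matrix (Fin 2) (Fin 2) ℤ)) 1 1) ∨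
          (((((g₀ : Matrix (Fin 2) (Fin 2) ℤ) * !![u, v; 0, w]).adjugate * (((uu⁻¹ : Gamma0 N) : SL(2, ℤ)) : Matrix (Fin 2) (Fin 2) ℤ)) 0 0 + 2 * (((g₀ : Matrix (Fin 2) (Fin 2) ℤ) * !![u, v; 0, w]).adjugate * (((uu⁻¹ : Gamma0 N) : SL(2, ℤ)) : Matrix (Fin 2) (Fin 2) ℤ)) 0 1) * ((((g₀ : Matrix (Fin 2) (Fin 2) ℤ) * !![u, v; 0, w]).adjugate * (((uu⁻¹ : Gamma0 N) : SL(2, ℤ)) : Matrix (Fin 2) (Fin 2) ℤ)) 1 0 + 2 * (((g₀ : Matrix (Fin 2) (Fin 2) ℤ) * !![u, v; 0, w]).adjugate * (((uu⁻¹ : Gamma0 N) : SL(2, ℤ)) : Matrix (Fin 2) (Fin 2) ℤ)) 1 1) = 0 ∧ 0 < (((g₀ : Matrix (Fin 2) (Fin 2) ℤ) * !![u, v; 0, w]).adjugate * (((uu⁻¹ : Gamma0 N) : SL(2, ℤ)) : Matrix (Fin 2) (Fin 2) ℤ)) 0 0 * (((g₀ : Matrix (Fin 2) (Fin 2) ℤ)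 * !![u, v; 0, w]).adjugate * (((uu⁻¹ : Gamma0 N) : SL(2, ℤ)) : Matrix (Fin 2) (Fin 2) ℤ)) 1 1 + (((g₀ : Matrix (Fin 2) (Fin 2) ℤ) * !![u, v; 0, w]).adjugate * (((uu⁻¹ : Gamma0 N) : SL(2, ℤ)) : Matrix (Fin 2) (Fin 2) ℤ)) 0 1 * (((g₀ : Matrix (Fin 2) (Fin 2) ℤ) * !![u, v; 0, w]).adjugate * (((uu⁻¹ : Gamma0 N) : SL(2, ℤ)) : Matrix (Fin 2) (Fin 2) ℤ)) 1 0)))) then (1 : ℤ) else 0))).Finite := by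
  obtain ⟨κ, hκ⟩ : ∃ κ : SL(2, ℤ) → ℤ, ∀ A, κ A = ((P.map fun f ↦ g₀ * f).map fun f ↦ (if (0 < (f⁻¹ * A) 0 0 * (f⁻¹ * A) 1 0 ∨ 0 < (f⁻¹ * A) 0 1 * (f⁻¹ * A) 1 1 ∨ 0 < ((f⁻¹ * A) 0 0 + (f⁻¹ * A) 0 1) * ((f⁻¹ * A) 1 0 + (f⁻¹ * A) 1 1)) then (1 : ℤ) else 0)).sum -
        (if (0 < (((g₀ : Matrix (Fin 2) (Fin 2) ℤ) * !![u, v; 0, w]).adjugate * (A : Matrix (Fin 2) (Fin 2) ℤ)) 0 0 * (((g₀ : Matrix (Fin 2) (Fin 2) ℤ) * !![u, v; 0, w]).adjugate * (A : Matrix (Fin 2) (Fin 2) ℤ)) 1 0 ∨ ((((g₀ : Matrix (Fin 2) (Fin 2) ℤ) * !![u, v; 0, w]).adjugate * (A : Matrix (Fin 2) (Fin 2) ℤ)) 0 0 * (((g₀ : Matrix (Fin 2) (Fin 2) ℤ) * !![u, v; 0, w]).adjugate * (A : Matrix (Fin 2) (Fin 2) ℤ)) 1 0 = 0 ∧ (0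 < ((((g₀ : Matrix (Fin 2) (Fin 2) ℤ) * !![u, v; 0, w]).adjugate * (A : Matrix (Fin 2) (Fin 2) ℤ)) 0 0 + 2 * (((g₀ : Matrix (Fin 2) (Fin 2) ℤ) * !![u, v; 0, w]).adjugate * (A : Matrix (Fin 2) (Fin 2) ℤ)) 0 1) * ((((g₀ : Matrix (Fin 2) (Fin 2) ℤ) * !![u, v; 0, w]).adjugate * (A : Matrix (Fin 2) (Fin 2) ℤ)) 1 0 + 2 * (((g₀ : Matrix (Fin 2) (Fin 2) ℤ) * !![u, v; 0, w]).adjugate * (A : Matrix (Fin 2) (Fin 2) ℤ)) 1 1) ∨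
          (((((g₀ : Matrix (Fin 2) (Fin 2) ℤ) * !![u, v; 0, w]).adjugate * (A : Matrix (Fin 2) (Fin 2) ℤ)) 0 0 + 2 * (((g₀ : Matrix (Fin 2) (Fin 2) ℤ) * !![u, v; 0, w]).adjugate * (A : Matrix (Fin 2) (Fin 2) ℤ)) 0 1) * ((((g₀ : Matrix (Fin 2) (Fin 2) ℤ) * !![u, v; 0, w]).adjugate * (A : Matrix (Fin 2) (Fin 2) ℤ)) 1 0 + 2 * (((g₀ : Matrix (Fin 2) (Fin 2) ℤ) * !![u, v; 0, w]).adjugate * (A : Matrix (Fin 2) (Fin 2) ℤ)) 1 1) = 0 ∧ 0 < (((g₀ : Matrix (Fin 2) (Fin 2) ℤ) * !![u, v; 0, w]).adjugate * (A : Matrix (Fin 2) (Fin 2) ℤ)) 0 0 * (((g₀ : Matrix (Fin 2) (Fin 2) ℤ) * !![u, v; 0, w]).adjugate * (A : Matrix (Fin 2) (Fin 2) ℤ)) 1 1 + (((g₀ : Matrix (Fin 2) (Fin 2) ℤ) * !![u, v; 0, w]).adjugate * (A : Matrix (Fin 2) (Fin 2) ℤ)) 0 1 * (((g₀ : Matrix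 (Fin 2) (Fin 2) ℤ) * !![u, v; 0, w]).adjugate * (A : Matrix (Fin 2) (Fin 2) ℤ)) 1 0)))) then (1 : ℤ) else 0) := ⟨_, fun A ↦ rfl⟩
  have hκfin : (Function.support κ).Finite := by
    have h := finite_kappa_support g₀ u v w d m x y P hu hd hm hx0 hy0 hypos hdet hvd hwd hlen hget
    refine h.subset fun A hA ↦ ?_
    rw [Function.mem_support, hκ] at hA
    exact hA
  have lsum : ∀ (l : List SL(2, ℤ)) (a b : SL(2, ℤ) → ℤ), (l.map fun f ↦ -(a f - b f)).sum = -((l.map a).sum - (l.map b).sum) := by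
    intro l a b; induction l with
    | nil => simp
    | cons f l ih => simp only [List.map_cons, List.sum_cons, ih]; ring
  have hfin : ∀ f : SL(2, ℤ), (Function.support fun uu : Gamma0 N ↦
      -((if (0 < (((uu : SL(2, ℤ)) * (g₀ * f))⁻¹ * (γ : SL(2, ℤ))) 0 0 * (((uu : SL(2, ℤ)) * (g₀ * f))⁻¹ * (γ : SL(2, ℤ))) 1 0 ∨ 0 < (((uu : SL(2, ℤ)) * (g₀ * f))⁻¹ * (γ : SL(2, ℤ))) 0 1 * (((uu : SL(2, ℤ)) * (g₀ * f))⁻¹ * (γ : SL(2, ℤ))) 1 1 ∨ 0 < ((((uu : SL(2, ℤ)) * (g₀ * f))⁻¹ * (γ : SL(2, ℤ))) 0 0 + (((uu : SL(2, ℤ)) * (g₀ * f))⁻¹ * (γ : SL(2, ℤ))) 0 1) * ((((uu : SL(2, ℤ)) * (g₀ * f))⁻¹ * (γ : SL(2, ℤ))) 1 0 + (((uu : SL(2, ℤ)) * (g₀ * f))⁻¹ * (γ : SL(2, ℤ))) 1 1)) then (1 : ℤ) else 0) -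
        (if (0 < (((uu : SL(2, ℤ)) * (g₀ * f))⁻¹ * 1) 0 0 * (((uu : SL(2, ℤ)) * (g₀ * f))⁻¹ * 1) 1 0 ∨ 0 < (((uu : SL(2, ℤ)) * (g₀ * f))⁻¹ * 1) 0 1 * (((uu : SL(2, ℤ)) * (g₀ * f))⁻¹ * 1) 1 1 ∨ 0 < ((((uu : SL(2, ℤ)) * (g₀ * f))⁻¹ * 1) 0 0 + (((uu : SL(2, ℤ)) * (g₀ * f))⁻¹ * 1) 0 1) * ((((uu : SL(2, ℤ)) * (g₀ * f))⁻¹ * 1) 1 0 + (((uu : SL(2, ℤ)) * (g₀ * f))⁻¹ * 1) 1 1)) then (1 : ℤ) else 0))).Finite :=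
    fun f ↦ (finite_support_sideDiff 1 (γ : SL(2, ℤ)) D hD (g₀ * f)).subset fun uu huu ↦ neg_ne_zero.mp huu
  obtain ⟨htotfin, -⟩ := finsum_list_sum_swap (fun f (uu : Gamma0 N) ↦
      -((if (0 < (((uu : SL(2, ℤ)) * (g₀ * f))⁻¹ * (γ : SL(2, ℤ))) 0 0 * (((uu : SL(2, ℤ)) * (g₀ * f))⁻¹ * (γ : SL(2, ℤ))) 1 0 ∨ 0 < (((uu : SL(2, ℤ)) * (g₀ * f))⁻¹ * (γ : SL(2, ℤ))) 0 1 * (((uu : SL(2, ℤ)) * (g₀ * f))⁻¹ * (γ : SL(2, ℤ))) 1 1 ∨ 0 < ((((uu : SL(2, ℤ)) * (g₀ * f))⁻¹ * (γ : SL(2, ℤ))) 0 0 + (((uu : SL(2, ℤ)) * (g₀ * f))⁻¹ * (γ : SL(2, ℤ))) 0 1) * ((((uu : SL(2, ℤ)) * (g₀ * f))⁻¹ * (γ : SL(2, ℤ))) 1 0 + (((uu : SL(2, ℤ)) * (g₀ * f))⁻¹ * (γ : SL(2, ℤ))) 1 1)) then (1 : ℤ) else 0) -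
        (if (0 < (((uu : SL(2, ℤ)) * (g₀ * f))⁻¹ * 1) 0 0 * (((uu : SL(2, ℤ)) * (g₀ * f))⁻¹ * 1) 1 0 ∨ 0 < (((uu : SL(2, ℤ)) * (g₀ * f))⁻¹ * 1) 0 1 * (((uu : SL(2, ℤ)) * (g₀ * f))⁻¹ * 1) 1 1 ∨ 0 < ((((uu : SL(2, ℤ)) * (g₀ * f))⁻¹ * 1) 0 0 + (((uu : SL(2, ℤ)) * (g₀ * f))⁻¹ * 1) 0 1) * ((((uu : SL(2, ℤ)) * (g₀ * f))⁻¹ * 1) 1 0 + (((uu : SL(2, ℤ)) * (g₀ * f))⁻¹ * 1) 1 1)) then (1 : ℤ) else 0))) hfin P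
  have hsumA : ∀ (uu : Gamma0 N) (k : SL(2, ℤ)), (P.map fun f ↦ (if (0 < (((uu : SL(2, ℤ)) * (g₀ * f))⁻¹ * k) 0 0 * (((uu : SL(2, ℤ)) * (g₀ * f))⁻¹ * k) 1 0 ∨ 0 < (((uu : SL(2, ℤ)) * (g₀ * f))⁻¹ * k) 0 1 * (((uu : SL(2, ℤ)) * (g₀ * f))⁻¹ * k) 1 1 ∨ 0 < ((((uu : SL(2, ℤ)) * (g₀ * f))⁻¹ * k) 0 0 + (((uu : SL(2, ℤ)) * (g₀ * f))⁻¹ * k) 0 1) * ((((uu : SL(2, ℤ)) * (g₀ * f))⁻¹ * k) 1 0 + (((uu : SL(2, ℤ)) * (g₀ * f))⁻¹ * k) 1 1)) then (1 : ℤ) else 0)).sum =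
      κ (((uu⁻¹ : Gamma0 N) : SL(2, ℤ)) * k) + (if (0 < (((g₀ : Matrix (Fin 2) (Fin 2) ℤ) * !![u, v; 0, w]).adjugate * ((((uu⁻¹ : Gamma0 N) : SL(2, ℤ)) * k : SL(2, ℤ)) : Matrix (Fin 2) (Fin 2) ℤ)) 0 0 * (((g₀ : Matrix (Fin 2) (Fin 2) ℤ) * !![u, v; 0, w]).adjugate * ((((uu⁻¹ : Gamma0 N) : SL(2, ℤ)) * k : SL(2, ℤ)) : Matrix (Fin 2) (Fin 2) ℤ)) 1 0 ∨ ((((g₀ : Matrix (Fin 2) (Fin 2) ℤ) * !![u, v; 0, w]).adjugate * ((((uu⁻¹ : Gamma0 N) : SL(2, ℤ)) * k : SL(2, ℤ)) : Matrix (Fin 2) (Fin 2) ℤ)) 0 0 * (((g₀ : Matrix (Fin 2) (Fin 2) ℤ) * !![u, v; 0, w]).adjugate * ((((uu⁻¹ : Gamma0 N) : SL(2, ℤ)) * k : SL(2, ℤ)) : Matrix (Fin 2) (Fin 2) ℤ)) 1 0 = 0 ∧ (0 < ((((g₀ : Matrix (Fin 2) (Fin 2) ℤ) * !![u, v; 0,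 w]).adjugate * ((((uu⁻¹ : Gamma0 N) : SL(2, ℤ)) * k : SL(2, ℤ)) : Matrix (Fin 2) (Fin 2) ℤ)) 0 0 + 2 * (((g₀ : Matrix (Fin 2) (Fin 2) ℤ) * !![u, v; 0, w]).adjugate * ((((uu⁻¹ : Gamma0 N) : SL(2, ℤ)) * k : SL(2, ℤ)) : Matrix (Fin 2) (Fin 2) ℤ)) 0 1) * ((((g₀ : Matrix (Fin 2) (Fin 2) ℤ) * !![u, v; 0, w]).adjugate * ((((uu⁻¹ : Gamma0 N) : SL(2, ℤ)) * k : SL(2, ℤ)) : Matrix (Fin 2) (Fin 2) ℤ)) 1 0 + 2 * (((g₀ : Matrix (Fin 2) (Fin 2) ℤ) * !![u, v; 0, w]).adjugate * ((((uu⁻¹ : Gamma0 N) : SL(2, ℤ)) * k : SL(2, ℤ)) : Matrix (Fin 2) (Fin 2) ℤ)) 1 1) ∨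
          (((((g₀ : Matrix (Fin 2) (Fin 2) ℤ) * !![u, v; 0, w]).adjugate * ((((uu⁻¹ : Gamma0 N) : SL(2, ℤ)) * k : SL(2, ℤ)) : Matrix (Fin 2) (Fin 2) ℤ)) 0 0 + 2 * (((g₀ : Matrix (Fin 2) (Fin 2) ℤ) * !![u, v; 0, w]).adjugate * ((((uu⁻¹ : Gamma0 N) : SL(2, ℤ)) * k : SL(2, ℤ)) : Matrix (Fin 2) (Fin 2) ℤ)) 0 1) * ((((g₀ : Matrix (Fin 2) (Fin 2) ℤ) * !![u, v; 0, w]).adjugate * ((((uu⁻¹ : Gamma0 N) : SL(2, ℤ)) * k : SL(2, ℤ)) : Matrix (Fin 2) (Fin 2) ℤ)) 1 0 + 2 * (((g₀ : Matrix (Fin 2) (Fin 2) ℤ) * !![u, v; 0, w]).adjugate * ((((uu⁻¹ : Gamma0 N) : SL(2, ℤ)) * k : SL(2, ℤ)) : Matrix (Fin 2) (Fin 2) ℤ)) 1 1) = 0 ∧ 0 < (((g₀ : Matrix (Fin 2) (Fin 2) ℤ) * !![u, v; 0, w]).adjugate * ((((uu⁻¹ : Gamma0 N) : SL(2, ℤ))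 * k : SL(2, ℤ)) : Matrix (Fin 2) (Fin 2) ℤ)) 0 0 * (((g₀ : Matrix (Fin 2) (Fin 2) ℤ) * !![u, v; 0, w]).adjugate * ((((uu⁻¹ : Gamma0 N) : SL(2, ℤ)) * k : SL(2, ℤ)) : Matrix (Fin 2) (Fin 2) ℤ)) 1 1 + (((g₀ : Matrix (Fin 2) (Fin 2) ℤ) * !![u, v; 0, w]).adjugate * ((((uu⁻¹ : Gamma0 N) : SL(2, ℤ)) * k : SL(2, ℤ)) : Matrix (Fin 2) (Fin 2) ℤ)) 0 1 * (((g₀ : Matrix (Fin 2) (Fin 2) ℤ) * !![u, v; 0, w]).adjugate * ((((uu⁻¹ : Gamma0 N) : SL(2, ℤ)) * k : SL(2, ℤ)) : Matrix (Fin 2) (Fin 2) ℤ)) 1 0)))) then (1 : ℤ) else 0) := by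
    intro uu k
    rw [hκ, sub_add_cancel, List.map_map]
    refine congrArg List.sum (List.map_congr_left fun f _ ↦ ?_)
    have e : ((uu : SL(2, ℤ)) * (g₀ * f))⁻¹ * k = (g₀ * f)⁻¹ * (((uu⁻¹ : Gamma0 N) : SL(2, ℤ)) * k) := by
      rw [Subgroup.coe_inv, mul_inv_rev, mul_assoc]
    rw [Function.comp_apply, e]
  have hpt : ∀ uu : Gamma0 N, (P.map fun f ↦
      -((if (0 < (((uu : SL(2, ℤ)) * (g₀ * f))⁻¹ * (γ : SL(2, ℤ))) 0 0 * (((uu : SL(2, ℤ)) * (g₀ * f))⁻¹ * (γ : SL(2, ℤ))) 1 0 ∨ 0 < (((uu : SL(2, ℤ)) * (g₀ * f))⁻¹ * (γ : SL(2, ℤ))) 0 1 * (((uu : SL(2, ℤ)) * (g₀ * f))⁻¹ * (γ : SL(2, ℤ))) 1 1 ∨ 0 < ((((uu : SL(2, ℤ)) * (g₀ * f))⁻¹ * (γ : SL(2, ℤ))) 0 0 + (((uu : SL(2, ℤ)) * (g₀ * f))⁻¹ * (γ : SL(2, ℤ))) 0 1) * ((((uu : SL(2, ℤ)) * (g₀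 * f))⁻¹ * (γ : SL(2, ℤ))) 1 0 + (((uu : SL(2, ℤ)) * (g₀ * f))⁻¹ * (γ : SL(2, ℤ))) 1 1)) then (1 : ℤ) else 0) -
        (if (0 < (((uu : SL(2, ℤ)) * (g₀ * f))⁻¹ * 1) 0 0 * (((uu : SL(2, ℤ)) * (g₀ * f))⁻¹ * 1) 1 0 ∨ 0 < (((uu : SL(2, ℤ)) * (g₀ * f))⁻¹ * 1) 0 1 * (((uu : SL(2, ℤ)) * (g₀ * f))⁻¹ * 1) 1 1 ∨ 0 < ((((uu : SL(2, ℤ)) * (g₀ * f))⁻¹ * 1) 0 0 + (((uu : SL(2, ℤ)) * (g₀ * f))⁻¹ * 1) 0 1) * ((((uu : SL(2, ℤ)) * (g₀ * f))⁻¹ * 1) 1 0 + (((uu : SL(2, ℤ)) * (g₀ * f))⁻¹ * 1) 1 1)) then (1 : ℤ) else 0))).sum =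
      -(κ (((uu⁻¹ : Gamma0 N) : SL(2, ℤ)) * γ) - κ ((uu⁻¹ : Gamma0 N) : SL(2, ℤ))) -
        ((if (0 < (((g₀ : Matrix (Fin 2) (Fin 2) ℤ) * !![u, v; 0, w]).adjugate * (((uu⁻¹ : Gamma0 N) : SL(2, ℤ)) : Matrix (Fin 2) (Fin 2) ℤ) * ((γ : SL(2, ℤ)) : Matrix (Fin 2) (Fin 2) ℤ)) 0 0 * (((g₀ : Matrix (Fin 2) (Fin 2) ℤ) * !![u, v; 0, w]).adjugate * (((uu⁻¹ : Gamma0 N) : SL(2, ℤ)) : Matrix (Fin 2) (Fin 2) ℤ) * ((γ : SL(2, ℤ)) : Matrix (Fin 2) (Fin 2) ℤ)) 1 0 ∨ ((((g₀ : Matrix (Fin 2) (Fin 2) ℤ) * !![u, v; 0, w]).adjugate * (((uu⁻¹ : Gamma0 N) : SL(2, ℤ)) : Matrix (Fin 2) (Fin 2) ℤ) * ((γ : SL(2, ℤ)) : Matrix (Fin 2) (Fin 2) ℤ)) 0 0 * (((g₀ : Matrix (Fin 2) (Fin 2) ℤ) * !![u, v; 0, w]).adjugate * (((uu⁻¹ :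 Gamma0 N) : SL(2, ℤ)) : Matrix (Fin 2) (Fin 2) ℤ) * ((γ : SL(2, ℤ)) : Matrix (Fin 2) (Fin 2) ℤ)) 1 0 = 0 ∧ (0 < ((((g₀ : Matrix (Fin 2) (Fin 2) ℤ) * !![u, v; 0, w]).adjugate * (((uu⁻¹ : Gamma0 N) : SL(2, ℤ)) : Matrix (Fin 2) (Fin 2) ℤ) * ((γ : SL(2, ℤ)) : Matrix (Fin 2) (Fin 2) ℤ)) 0 0 + 2 * (((g₀ : Matrix (Fin 2) (Fin 2) ℤ) * !![u, v; 0, w]).adjugate * (((uu⁻¹ : Gamma0 N) : SL(2, ℤ)) : Matrix (Fin 2) (Fin 2) ℤ) * ((γ : SL(2, ℤ)) : Matrix (Fin 2) (Fin 2) ℤ)) 0 1) * ((((g₀ : Matrix (Fin 2) (Fin 2) ℤ) * !![u, v; 0, w]).adjugate * (((uu⁻¹ : Gamma0 N) : SL(2, ℤ)) : Matrix (Fin 2) (Fin 2) ℤ) * ((γ : SL(2, ℤ)) : Matrix (Fin 2) (Fin 2) ℤ)) 1 0 + 2 * (((g₀ : Matrix (Fin 2) (Fin 2) ℤ) * !![u,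 v; 0, w]).adjugate * (((uu⁻¹ : Gamma0 N) : SL(2, ℤ)) : Matrix (Fin 2) (Fin 2) ℤ) * ((γ : SL(2, ℤ)) : Matrix (Fin 2) (Fin 2) ℤ)) 1 1) ∨
          (((((g₀ : Matrix (Fin 2) (Fin 2) ℤ) * !![u, v; 0, w]).adjugate * (((uu⁻¹ : Gamma0 N) : SL(2, ℤ)) : Matrix (Fin 2) (Fin 2) ℤ) * ((γ : SL(2, ℤ)) : Matrix (Fin 2) (Fin 2) ℤ)) 0 0 + 2 * (((g₀ : Matrix (Fin 2) (Fin 2) ℤ) * !![u, v; 0, w]).adjugate * (((uu⁻¹ : Gamma0 N) : SL(2, ℤ)) : Matrix (Fin 2) (Fin 2) ℤ) * ((γ : SL(2, ℤ)) : Matrix (Fin 2) (Fin 2) ℤ)) 0 1) * ((((g₀ : Matrix (Fin 2) (Fin 2) ℤ) * !![u, v; 0, w]).adjugate * (((uu⁻¹ : Gamma0 N) : SL(2, ℤ)) : Matrix (Fin 2) (Fin 2) ℤ) * ((γ : SL(2, ℤ)) : Matrix (Fin 2) (Fin 2) ℤ)) 1 0 + 2 * (((g₀ : Matrix (Fin 2)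 (Fin 2) ℤ) * !![u, v; 0, w]).adjugate * (((uu⁻¹ : Gamma0 N) : SL(2, ℤ)) : Matrix (Fin 2) (Fin 2) ℤ) * ((γ : SL(2, ℤ)) : Matrix (Fin 2) (Fin 2) ℤ)) 1 1) = 0 ∧ 0 < (((g₀ : Matrix (Fin 2) (Fin 2) ℤ) * !![u, v; 0, w]).adjugate * (((uu⁻¹ : Gamma0 N) : SL(2, ℤ)) : Matrix (Fin 2) (Fin 2) ℤ) * ((γ : SL(2, ℤ)) : Matrix (Fin 2) (Fin 2) ℤ)) 0 0 * (((g₀ : Matrix (Fin 2) (Fin 2) ℤ) * !![u, v; 0, w]).adjugate * (((uu⁻¹ : Gamma0 N) : SL(2, ℤ)) : Matrix (Fin 2) (Fin 2) ℤ) * ((γ : SL(2, ℤ)) : Matrix (Fin 2) (Fin 2) ℤ)) 1 1 + (((g₀ : Matrix (Fin 2) (Fin 2) ℤ) * !![u, v; 0, w]).adjugate * (((uu⁻¹ : Gamma0 N) : SL(2, ℤ)) : Matrix (Fin 2) (Fin 2) ℤ) * ((γ : SL(2, ℤ)) : Matrix (Fin 2) (Fin 2) ℤ)) 0 1 * (((g₀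 : Matrix (Fin 2) (Fin 2) ℤ) * !![u, v; 0, w]).adjugate * (((uu⁻¹ : Gamma0 N) : SL(2, ℤ)) : Matrix (Fin 2) (Fin 2) ℤ) * ((γ : SL(2, ℤ)) : Matrix (Fin 2) (Fin 2) ℤ)) 1 0)))) then (1 : ℤ) else 0) -
         (if (0 < (((g₀ : Matrix (Fin 2) (Fin 2) ℤ) * !![u, v; 0, w]).adjugate * (((uu⁻¹ : Gamma0 N) : SL(2, ℤ)) : Matrix (Fin 2) (Fin 2) ℤ)) 0 0 * (((g₀ : Matrix (Fin 2) (Fin 2) ℤ) * !![u, v; 0, w]).adjugate * (((uu⁻¹ : Gamma0 N) : SL(2, ℤ)) : Matrix (Fin 2) (Fin 2) ℤ)) 1 0 ∨ ((((g₀ : Matrix (Fin 2) (Fin 2) ℤ) * !![u, v; 0, w]).adjugate * (((uu⁻¹ : Gamma0 N) : SL(2, ℤ)) : Matrix (Fin 2) (Fin 2) ℤ)) 0 0 * (((g₀ : Matrix (Fin 2) (Fin 2) ℤ) * !![u, v; 0, w]).adjugate * (((uu⁻¹ : Gamma0 N) : SL(2, ℤ)) : Matrix (Fin 2) (Fin 2)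 ℤ)) 1 0 = 0 ∧ (0 < ((((g₀ : Matrix (Fin 2) (Fin 2) ℤ) * !![u, v; 0, w]).adjugate * (((uu⁻¹ : Gamma0 N) : SL(2, ℤ)) : Matrix (Fin 2) (Fin 2) ℤ)) 0 0 + 2 * (((g₀ : Matrix (Fin 2) (Fin 2) ℤ) * !![u, v; 0, w]).adjugate * (((uu⁻¹ : Gamma0 N) : SL(2, ℤ)) : Matrix (Fin 2) (Fin 2) ℤ)) 0 1) * ((((g₀ : Matrix (Fin 2) (Fin 2) ℤ) * !![u, v; 0, w]).adjugate * (((uu⁻¹ : Gamma0 N) : SL(2, ℤ)) : Matrix (Fin 2) (Fin 2) ℤ)) 1 0 + 2 * (((g₀ : Matrix (Fin 2) (Fin 2) ℤ) * !![u, v; 0, w]).adjugate * (((uu⁻¹ : Gamma0 N) : SL(2, ℤ)) : Matrix (Fin 2) (Fin 2) ℤ)) 1 1) ∨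
          (((((g₀ : Matrix (Fin 2) (Fin 2) ℤ) * !![u, v; 0, w]).adjugate * (((uu⁻¹ : Gamma0 N) : SL(2, ℤ)) : Matrix (Fin 2) (Fin 2) ℤ)) 0 0 + 2 * (((g₀ : Matrix (Fin 2) (Fin 2) ℤ) * !![u, v; 0, w]).adjugate * (((uu⁻¹ : Gamma0 N) : SL(2, ℤ)) : Matrix (Fin 2) (Fin 2) ℤ)) 0 1) * ((((g₀ : Matrix (Fin 2) (Fin 2) ℤ) * !![u, v; 0, w]).adjugate * (((uu⁻¹ : Gamma0 N) : SL(2, ℤ)) : Matrix (Fin 2) (Fin 2) ℤ)) 1 0 + 2 * (((g₀ : Matrix (Fin 2) (Fin 2) ℤ) * !![u, v; 0, w]).adjugate * (((uu⁻¹ : Gamma0 N) : SL(2, ℤ)) : Matrix (Fin 2) (Fin 2) ℤ)) 1 1) = 0 ∧ 0 < (((g₀ : Matrix (Fin 2) (Fin 2) ℤ) * !![u, v; 0, w]).adjugate * (((uu⁻¹ : Gamma0 N) : SL(2, ℤ)) : Matrix (Fin 2) (Fin 2) ℤ)) 0 0 * (((g₀ : Matrix (Fin 2) (Fin 2) ℤ)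 * !![u, v; 0, w]).adjugate * (((uu⁻¹ : Gamma0 N) : SL(2, ℤ)) : Matrix (Fin 2) (Fin 2) ℤ)) 1 1 + (((g₀ : Matrix (Fin 2) (Fin 2) ℤ) * !![u, v; 0, w]).adjugate * (((uu⁻¹ : Gamma0 N) : SL(2, ℤ)) : Matrix (Fin 2) (Fin 2) ℤ)) 0 1 * (((g₀ : Matrix (Fin 2) (Fin 2) ℤ) * !![u, v; 0, w]).adjugate * (((uu⁻¹ : Gamma0 N) : SL(2, ℤ)) : Matrix (Fin 2) (Fin 2) ℤ)) 1 0)))) then (1 : ℤ) else 0)) := by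
    intro uu
    rw [lsum, hsumA uu (γ : SL(2, ℤ)), hsumA uu 1, mul_one, Matrix.SpecialLinearGroup.coe_mul, ← Matrix.mul_assoc]
    ring
  have hκbr : (Function.support fun uu : Gamma0 N ↦
      -(κ (((uu⁻¹ : Gamma0 N) : SL(2, ℤ)) * γ) - κ ((uu⁻¹ : Gamma0 N) : SL(2, ℤ)))).Finite := by
    apply Set.Finite.subset (s := (Function.support fun uu : Gamma0 N ↦ κ (((uu⁻¹ : Gamma0 N) : SL(2, ℤ)) * γ)) ∪
      Function.support fun uu : Gamma0 N ↦ κ ((uu⁻¹ : Gamma0 N) : SL(2, ℤ)))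
    · refine Set.Finite.union ?_ ?_
      · refine hκfin.preimage ?_
        intro a _ b _ h
        have h' : ((a⁻¹ : Gamma0 N) : SL(2, ℤ)) = ((b⁻¹ : Gamma0 N) : SL(2, ℤ)) := mul_right_cancel h
        exact inv_injective (Subtype.coe_injective h')
      · refine hκfin.preimage ?_
        intro a _ b _ h
        exact inv_injective (Subtype.coe_injective h)
    · intro uu huu
      rw [Function.mem_support] at huu
      by_contra hcon
      simp only [Set.mem_union, Function.mem_support, not_or, not_not] at hcon
      exact huu (by rw [hcon.1, hcon.2, sub_zero, neg_zero])
  apply Set.Finite.subset (htotfin.union hκbr)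
  intro uu huu
  rw [Function.mem_support] at huu
  by_contra hcon
  simp only [Set.mem_union, Function.mem_support, not_or, not_not] at hcon
  have h1 := hcon.1
  rw [hpt uu, hcon.2, zero_sub, neg_eq_zero] at h1
  exact huu h1

end ManinSupport

section ManinSum

variable {N : ℕ} [NeZero N]

/-- **Manin side of the transpose identity (brick HA8-M').** Let `B` satisfy w2's crossing formula, `L` be a Manin chain of `γ'`, and
`α_i γ' = δ_i α_{σ i}` a Hecke cocycle with UPPER-TRIANGULAR integer representatives of positive determinant. Then
`2·Σ_i B({∞,γ∞}, {∞,δ_i∞}) = Σ_{g∈L} Σ_i Σ'_{u∈Γ₀(N)} [F(g⁻¹·adj(α_i)·u⁻¹·γ) − F(g⁻¹·adj(α_i)·u⁻¹)]`.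
[cite: Merel1995Homologie, §2.1–2.2] [cite: Manin1972, §1.5] -/
theorem manin_side_flag_sum (B : periodHomologyHecke N →+ (periodHomologyHecke N →+ ℤ))
    (hB : ∀ (γ γ' : Gamma0 N) (D L : List SL(2, ℤ)),
      (∀ {A : Type} [AddCommGroup A] (G : SL(2, ℤ) → A), (∀ x, G (x * (S * T⁻¹)) = G x) → (∀ x, G (-x) = G x) →
        (D.map fun h ↦ G h - G (h * S)).sum = G (γ : SL(2, ℤ)) - G 1) →
      (∀ {A : Type} [AddCommGroup A] (F : SL(2, ℤ) → A), (∀ g, F (g * T) = F g) → (∀ g, F (-g) = F g) →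
        (L.map fun g ↦ F g - F (g * S)).sum = F (γ' : SL(2, ℤ)) - F 1) →
      B ⟨periodFunctional N γ, (mem_periodHomologyHecke N).mpr (periodFunctional_mem_periodHomology N γ)⟩
        ⟨periodFunctional N γ', (mem_periodHomologyHecke N).mpr (periodFunctional_mem_periodHomology N γ')⟩ =
        (L.map fun g ↦ (D.map fun h ↦ (Pi.single ((h⁻¹ : SL(2, ℤ)) : Gamma0Coset N) (1 : ℤ) -
          Pi.single (((h * S)⁻¹ : SL(2, ℤ)) : Gamma0Coset N) 1 : Gamma0Coset N → ℤ)).sum ((g⁻¹ : SL(2, ℤ)) : Gamma0Coset N)).sum)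
    (γ γ' : Gamma0 N) (L : List SL(2, ℤ))
    (hL : ∀ {A : Type} [AddCommGroup A] (F : SL(2, ℤ) → A), (∀ g, F (g * T) = F g) → (∀ g, F (-g) = F g) →
      (L.map fun g ↦ F g - F (g * S)).sum = F (γ' : SL(2, ℤ)) - F 1)
    {ι : Type} [Fintype ι] (α : ι → Matrix (Fin 2) (Fin 2) ℤ) (hdet : ∀ i, 0 < (α i).det) (hup : ∀ i, α i 1 0 = 0)
    (δ : ι → Gamma0 N) (σ : Equiv.Perm ι)
    (hcoc : ∀ i, α i * ((γ' : SL(2, ℤ)) : Matrix (Fin 2) (Fin 2) ℤ) = (((δ i : Gamma0 N) : SL(2, ℤ)) : Matrix (Fin 2) (Fin 2) ℤ) * α (σ i)) :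
    2 * ∑ i, B ⟨periodFunctional N γ, (mem_periodHomologyHecke N).mpr (periodFunctional_mem_periodHomology N γ)⟩
        ⟨periodFunctional N (δ i), (mem_periodHomologyHecke N).mpr (periodFunctional_mem_periodHomology N (δ i))⟩ =
      (L.map fun g ↦ ∑ i, ∑ᶠ u : Gamma0 N,
        ((if (0 < (((g⁻¹ : SL(2, ℤ)) : Matrix (Fin 2) (Fin 2) ℤ) * (α i).adjugate * (((u⁻¹ : Gamma0 N) : SL(2, ℤ)) : Matrix (Fin 2) (Fin 2) ℤ) * ((γ : SL(2, ℤ)) : Matrix (Fin 2) (Fin 2) ℤ)) 0 0 * (((g⁻¹ : SL(2, ℤ)) : Matrix (Fin 2) (Fin 2) ℤ) * (α i).adjugate * (((u⁻¹ : Gamma0 N) : SL(2, ℤ)) : Matrix (Fin 2) (Fin 2) ℤ) * ((γ : SL(2, ℤ)) : Matrix (Fin 2) (Fin 2) ℤ)) 1 0 ∨ ((((g⁻¹ : SL(2, ℤ)) : Matrix (Fin 2) (Fin 2) ℤ) * (α i).adjugate * (((u⁻¹ : Gamma0 N) : SL(2, ℤ)) : Matrix (Fin 2) (Fin 2) ℤ)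 * ((γ : SL(2, ℤ)) : Matrix (Fin 2) (Fin 2) ℤ)) 0 0 * (((g⁻¹ : SL(2, ℤ)) : Matrix (Fin 2) (Fin 2) ℤ) * (α i).adjugate * (((u⁻¹ : Gamma0 N) : SL(2, ℤ)) : Matrix (Fin 2) (Fin 2) ℤ) * ((γ : SL(2, ℤ)) : Matrix (Fin 2) (Fin 2) ℤ)) 1 0 = 0 ∧ (0 < ((((g⁻¹ : SL(2, ℤ)) : Matrix (Fin 2) (Fin 2) ℤ) * (α i).adjugate * (((u⁻¹ : Gamma0 N) : SL(2, ℤ)) : Matrix (Fin 2) (Fin 2) ℤ) * ((γ : SL(2, ℤ)) : Matrix (Fin 2) (Fin 2) ℤ)) 0 0 + 2 * (((g⁻¹ : SL(2, ℤ)) : Matrix (Fin 2) (Fin 2) ℤ) * (α i).adjugate * (((u⁻¹ : Gamma0 N) : SL(2, ℤ)) : Matrix (Fin 2) (Fin 2) ℤ) * ((γ : SL(2, ℤ)) : Matrix (Fin 2) (Fin 2) ℤ)) 0 1) * ((((g⁻¹ : SL(2, ℤ)) : Matrix (Fin 2) (Fin 2) ℤ) * (α i).adjugate * (((u⁻¹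 : Gamma0 N) : SL(2, ℤ)) : Matrix (Fin 2) (Fin 2) ℤ) * ((γ : SL(2, ℤ)) : Matrix (Fin 2) (Fin 2) ℤ)) 1 0 + 2 * (((g⁻¹ : SL(2, ℤ)) : Matrix (Fin 2) (Fin 2) ℤ) * (α i).adjugate * (((u⁻¹ : Gamma0 N) : SL(2, ℤ)) : Matrix (Fin 2) (Fin 2) ℤ) * ((γ : SL(2, ℤ)) : Matrix (Fin 2) (Fin 2) ℤ)) 1 1) ∨
          (((((g⁻¹ : SL(2, ℤ)) : Matrix (Fin 2) (Fin 2) ℤ) * (α i).adjugate * (((u⁻¹ : Gamma0 N) : SL(2, ℤ)) : Matrix (Fin 2) (Fin 2) ℤ) * ((γ : SL(2, ℤ)) : Matrix (Fin 2) (Fin 2) ℤ)) 0 0 + 2 * (((g⁻¹ : SL(2, ℤ)) : Matrix (Fin 2) (Fin 2) ℤ) * (α i).adjugate * (((u⁻¹ : Gamma0 N) : SL(2, ℤ)) : Matrix (Fin 2) (Fin 2) ℤ) * ((γ : SL(2, ℤ)) : Matrix (Fin 2) (Fin 2) ℤ)) 0 1) * ((((g⁻¹ : SL(2, ℤ)) :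 Matrix (Fin 2) (Fin 2) ℤ) * (α i).adjugate * (((u⁻¹ : Gamma0 N) : SL(2, ℤ)) : Matrix (Fin 2) (Fin 2) ℤ) * ((γ : SL(2, ℤ)) : Matrix (Fin 2) (Fin 2) ℤ)) 1 0 + 2 * (((g⁻¹ : SL(2, ℤ)) : Matrix (Fin 2) (Fin 2) ℤ) * (α i).adjugate * (((u⁻¹ : Gamma0 N) : SL(2, ℤ)) : Matrix (Fin 2) (Fin 2) ℤ) * ((γ : SL(2, ℤ)) : Matrix (Fin 2) (Fin 2) ℤ)) 1 1) = 0 ∧ 0 < (((g⁻¹ : SL(2, ℤ)) : Matrix (Fin 2) (Fin 2) ℤ) * (α i).adjugate * (((u⁻¹ : Gamma0 N) : SL(2, ℤ)) : Matrix (Fin 2) (Fin 2) ℤ) * ((γ : SL(2, ℤ)) : Matrix (Fin 2) (Fin 2) ℤ)) 0 0 * (((g⁻¹ : SL(2, ℤ)) : Matrix (Fin 2) (Fin 2) ℤ) * (α i).adjugate * (((u⁻¹ : Gamma0 N) : SL(2, ℤ)) : Matrix (Fin 2) (Fin 2) ℤ) * ((γ : SL(2, ℤ)) : Matrix (Fin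 2) (Fin 2) ℤ)) 1 1 + (((g⁻¹ : SL(2, ℤ)) : Matrix (Fin 2) (Fin 2) ℤ) * (α i).adjugate * (((u⁻¹ : Gamma0 N) : SL(2, ℤ)) : Matrix (Fin 2) (Fin 2) ℤ) * ((γ : SL(2, ℤ)) : Matrix (Fin 2) (Fin 2) ℤ)) 0 1 * (((g⁻¹ : SL(2, ℤ)) : Matrix (Fin 2) (Fin 2) ℤ) * (α i).adjugate * (((u⁻¹ : Gamma0 N) : SL(2, ℤ)) : Matrix (Fin 2) (Fin 2) ℤ) * ((γ : SL(2, ℤ)) : Matrix (Fin 2) (Fin 2) ℤ)) 1 0)))) then (1 : ℤ) else 0) -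
         (if (0 < (((g⁻¹ : SL(2, ℤ)) : Matrix (Fin 2) (Fin 2) ℤ) * (α i).adjugate * (((u⁻¹ : Gamma0 N) : SL(2, ℤ)) : Matrix (Fin 2) (Fin 2) ℤ)) 0 0 * (((g⁻¹ : SL(2, ℤ)) : Matrix (Fin 2) (Fin 2) ℤ) * (α i).adjugate * (((u⁻¹ : Gamma0 N) : SL(2, ℤ)) : Matrix (Fin 2) (Fin 2) ℤ)) 1 0 ∨ ((((g⁻¹ : SL(2, ℤ)) : Matrix (Fin 2) (Fin 2) ℤ) * (α i).adjugate * (((u⁻¹ : Gamma0 N) : SL(2, ℤ)) : Matrix (Fin 2) (Fin 2) ℤ)) 0 0 * (((g⁻¹ : SL(2, ℤ)) : Matrix (Fin 2) (Fin 2) ℤ) * (α i).adjugate * (((u⁻¹ : Gamma0 N) : SL(2, ℤ)) : Matrix (Fin 2) (Fin 2) ℤ)) 1 0 = 0 ∧ (0 < ((((g⁻¹ : SL(2, ℤ)) : Matrix (Fin 2) (Fin 2) ℤ) * (α i).adjugate * (((u⁻¹ : Gamma0 N) : SL(2, ℤ)) : Matrix (Fin 2) (Fin 2) ℤ)) 0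 0 + 2 * (((g⁻¹ : SL(2, ℤ)) : Matrix (Fin 2) (Fin 2) ℤ) * (α i).adjugate * (((u⁻¹ : Gamma0 N) : SL(2, ℤ)) : Matrix (Fin 2) (Fin 2) ℤ)) 0 1) * ((((g⁻¹ : SL(2, ℤ)) : Matrix (Fin 2) (Fin 2) ℤ) * (α i).adjugate * (((u⁻¹ : Gamma0 N) : SL(2, ℤ)) : Matrix (Fin 2) (Fin 2) ℤ)) 1 0 + 2 * (((g⁻¹ : SL(2, ℤ)) : Matrix (Fin 2) (Fin 2) ℤ) * (α i).adjugate * (((u⁻¹ : Gamma0 N) : SL(2, ℤ)) : Matrix (Fin 2) (Fin 2) ℤ)) 1 1) ∨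
          (((((g⁻¹ : SL(2, ℤ)) : Matrix (Fin 2) (Fin 2) ℤ) * (α i).adjugate * (((u⁻¹ : Gamma0 N) : SL(2, ℤ)) : Matrix (Fin 2) (Fin 2) ℤ)) 0 0 + 2 * (((g⁻¹ : SL(2, ℤ)) : Matrix (Fin 2) (Fin 2) ℤ) * (α i).adjugate * (((u⁻¹ : Gamma0 N) : SL(2, ℤ)) : Matrix (Fin 2) (Fin 2) ℤ)) 0 1) * ((((g⁻¹ : SL(2, ℤ)) : Matrix (Fin 2) (Fin 2) ℤ) * (α i).adjugate * (((u⁻¹ : Gamma0 N) : SL(2, ℤ)) : Matrix (Fin 2) (Fin 2) ℤ)) 1 0 + 2 * (((g⁻¹ : SL(2, ℤ)) : Matrix (Fin 2) (Fin 2) ℤ) * (α i).adjugate * (((u⁻¹ : Gamma0 N) : SL(2, ℤ)) : Matrix (Fin 2) (Fin 2) ℤ)) 1 1) = 0 ∧ 0 < (((g⁻¹ : SL(2, ℤ)) : Matrix (Fin 2) (Fin 2) ℤ) * (α i).adjugate * (((u⁻¹ : Gamma0 N) : SL(2, ℤ)) : Matrix (Fin 2) (Fin 2) ℤ)) 0 0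 * (((g⁻¹ : SL(2, ℤ)) : Matrix (Fin 2) (Fin 2) ℤ) * (α i).adjugate * (((u⁻¹ : Gamma0 N) : SL(2, ℤ)) : Matrix (Fin 2) (Fin 2) ℤ)) 1 1 + (((g⁻¹ : SL(2, ℤ)) : Matrix (Fin 2) (Fin 2) ℤ) * (α i).adjugate * (((u⁻¹ : Gamma0 N) : SL(2, ℤ)) : Matrix (Fin 2) (Fin 2) ℤ)) 0 1 * (((g⁻¹ : SL(2, ℤ)) : Matrix (Fin 2) (Fin 2) ℤ) * (α i).adjugate * (((u⁻¹ : Gamma0 N) : SL(2, ℤ)) : Matrix (Fin 2) (Fin 2) ℤ)) 1 0)))) then (1 : ℤ) else 0))).sum := by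
  -- a dual chain of `γ`
  obtain ⟨D, hD⟩ := exists_dualChain ((γ : SL(2, ℤ)))
  -- re-expansion data of the generalised edges `C_{i,g} = α_i g S`
  have hdetC : ∀ (i : ι) (g : SL(2, ℤ)), 0 < (α i * ((g : SL(2, ℤ)) : Matrix (Fin 2) (Fin 2) ℤ) * ((S : SL(2, ℤ)) : Matrix (Fin 2) (Fin 2) ℤ)).det := by
    intro i g; rw [Matrix.det_mul, Matrix.det_mul, Matrix.SpecialLinearGroup.det_coe, Matrix.SpecialLinearGroup.det_coe, mul_one, mul_one]
    exact hdet i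
  choose g₀ u v w m x y P h₁ d hu hw hCeq hm hx0 hy0 hypos hdetc hconv hd hvd hwd hlen hget h100 h110 htel hc0 hc1 using
    fun (i : ι) (g : SL(2, ℤ)) ↦ exists_reexpansion (α i * ((g : SL(2, ℤ)) : Matrix (Fin 2) (Fin 2) ℤ) * ((S : SL(2, ℤ)) : Matrix (Fin 2) (Fin 2) ℤ)) (hdetC i g)
  -- Manin chains of the `δ_i`
  have hL' : ∀ i, ∀ {A : Type} [AddCommGroup A] (F : SL(2, ℤ) → A), (∀ g, F (g * T) = F g) → (∀ g, F (-g) = F g) →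
      ((L.flatMap fun g ↦ (P i g).map fun f ↦ g₀ i g * f * S).map fun x ↦ F x - F (x * S)).sum = F ((δ i : Gamma0 N) : SL(2, ℤ)) - F 1 :=
    fun i _ _ F hT hneg ↦ maninChain_of_reexpansions (α i) (α (σ i)) (hup i) (hup (σ i)) (hdet i) γ' (δ i) (hcoc i) L hL
      (g₀ i) (h₁ i) (P i) (u i) (d i) (fun g ↦ (hu i g).ne') (fun g ↦ (hd i g).ne') (htel i) (hc0 i) (hc1 i) F hT hneg
  have hBi : ∀ i, B ⟨periodFunctional N γ, (mem_periodHomologyHecke N).mpr (periodFunctional_mem_periodHomology N γ)⟩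
      ⟨periodFunctional N (δ i), (mem_periodHomologyHecke N).mpr (periodFunctional_mem_periodHomology N (δ i))⟩ =
      (L.map fun g ↦ ((P i g).map fun f ↦ (D.map fun h ↦ (Pi.single ((h⁻¹ : SL(2, ℤ)) : Gamma0Coset N) (1 : ℤ) -
          Pi.single (((h * S)⁻¹ : SL(2, ℤ)) : Gamma0Coset N) 1 : Gamma0Coset N → ℤ)).sum (((g₀ i g * f * S)⁻¹ : SL(2, ℤ)) : Gamma0Coset N)).sum).sum := by
    intro i
    rw [hB γ (δ i) D _ hD (hL' i), list_sum_map_flatMap]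
    refine congrArg List.sum (List.map_congr_left fun g _ ↦ ?_)
    rw [List.map_map]
    rfl
  simp_rw [hBi]
  rw [sum_list_map_swap, ← List.sum_map_mul_left]
  refine congrArg List.sum (List.map_congr_left fun g _ ↦ ?_)
  rw [Finset.mul_sum]
  refine Finset.sum_congr rfl fun i _ ↦ ?_
  -- the block identity and the outer reversal
  have hblock := manin_block γ D hD (g₀ i g) (u i g) (v i g) (w i g) (d i g) (m i g) (x i g) (y i g) (P i g)
    (hu i g) (hd i g) (hm i g) (hx0 i g) (hy0 i g) (hypos i g) (hdetc i g) (hvd i g) (hwd i g) (hlen i g) (hget i g)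
  rw [← hCeq i g] at hblock
  rw [hblock, ← finsum_neg_distrib]
  refine finsum_congr fun u ↦ ?_
  have hadj : (α i * ((g : SL(2, ℤ)) : Matrix (Fin 2) (Fin 2) ℤ) * ((S : SL(2, ℤ)) : Matrix (Fin 2) (Fin 2) ℤ)).adjugate =
      ((S⁻¹ : SL(2, ℤ)) : Matrix (Fin 2) (Fin 2) ℤ) * (((g⁻¹ : SL(2, ℤ)) : Matrix (Fin 2) (Fin 2) ℤ) * (α i).adjugate) := by
    rw [Matrix.adjugate_mul_distrib, Matrix.adjugate_mul_distrib, Matrix.SpecialLinearGroup.coe_inv, Matrix.SpecialLinearGroup.coe_inv]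
  have hdetα : (α i).adjugate.det ≠ 0 := by
    rw [Matrix.det_adjugate]; simp; exact (hdet i).ne'
  have hZ1 : (((g⁻¹ : SL(2, ℤ)) : Matrix (Fin 2) (Fin 2) ℤ) * (α i).adjugate * (((u⁻¹ : Gamma0 N) : SL(2, ℤ)) : Matrix (Fin 2) (Fin 2) ℤ) * ((γ : SL(2, ℤ)) : Matrix (Fin 2) (Fin 2) ℤ)).det ≠ 0 := by
    rw [Matrix.det_mul, Matrix.det_mul, Matrix.det_mul, Matrix.SpecialLinearGroup.det_coe, Matrix.SpecialLinearGroup.det_coe,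
      Matrix.SpecialLinearGroup.det_coe]; simpa using hdetα
  have hZ0 : (((g⁻¹ : SL(2, ℤ)) : Matrix (Fin 2) (Fin 2) ℤ) * (α i).adjugate * (((u⁻¹ : Gamma0 N) : SL(2, ℤ)) : Matrix (Fin 2) (Fin 2) ℤ)).det ≠ 0 := by
    rw [Matrix.det_mul, Matrix.det_mul, Matrix.SpecialLinearGroup.det_coe, Matrix.SpecialLinearGroup.det_coe]; simpa using hdetα
  have e1 : (α i * ((g : SL(2, ℤ)) : Matrix (Fin 2) (Fin 2) ℤ) * ((S : SL(2, ℤ)) : Matrix (Fin 2) (Fin 2) ℤ)).adjugate * (((u⁻¹ : Gamma0 N) : SL(2, ℤ)) : Matrix (Fin 2) (Fin 2) ℤ) * ((γ : SL(2, ℤ)) : Matrix (Fin 2) (Fin 2) ℤ) =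
      ((S⁻¹ : SL(2, ℤ)) : Matrix (Fin 2) (Fin 2) ℤ) * (((g⁻¹ : SL(2, ℤ)) : Matrix (Fin 2) (Fin 2) ℤ) * (α i).adjugate * (((u⁻¹ : Gamma0 N) : SL(2, ℤ)) : Matrix (Fin 2) (Fin 2) ℤ) * ((γ : SL(2, ℤ)) : Matrix (Fin 2) (Fin 2) ℤ)) := by
    rw [hadj]; simp only [Matrix.mul_assoc]
  have e0 : (α i * ((g : SL(2, ℤ)) : Matrix (Fin 2) (Fin 2) ℤ) * ((S : SL(2, ℤ)) : Matrix (Fin 2) (Fin 2) ℤ)).adjugate * (((u⁻¹ : Gamma0 N) : SL(2, ℤ)) : Matrix (Fin 2) (Fin 2) ℤ) =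
      ((S⁻¹ : SL(2, ℤ)) : Matrix (Fin 2) (Fin 2) ℤ) * (((g⁻¹ : SL(2, ℤ)) : Matrix (Fin 2) (Fin 2) ℤ) * (α i).adjugate * (((u⁻¹ : Gamma0 N) : SL(2, ℤ)) : Matrix (Fin 2) (Fin 2) ℤ)) := by
    rw [hadj]; simp only [Matrix.mul_assoc]
  rw [e1, e0, flagSide_Sinv_mul _ hZ1, flagSide_Sinv_mul _ hZ0]
  ring

omit [NeZero N] in
/-- **Finite support of the Manin-side summand**: for an integer matrix `M` of positive determinant, `g ∈ SL₂(ℤ)` and `γ ∈ Γ₀(N)`, only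
finitely many `u ∈ Γ₀(N)` contribute to `F(g⁻¹·adj(M)·u⁻¹·γ) − F(g⁻¹·adj(M)·u⁻¹)` (re-expansion of `M g S` + `manin_block_support` + the
outer edge reversal). [cite: Merel1995Homologie, §2.1] -/
theorem finite_support_manin_summand (γ : Gamma0 N) (M : Matrix (Fin 2) (Fin 2) ℤ) (hM : 0 < M.det) (g : SL(2, ℤ)) :
    (Function.support fun u : Gamma0 N ↦
        ((if (0 < (((g⁻¹ : SL(2, ℤ)) : Matrix (Fin 2) (Fin 2) ℤ) * M.adjugate * (((u⁻¹ : Gamma0 N) : SL(2, ℤ)) : Matrix (Fin 2) (Fin 2) ℤ) * ((γ : SL(2, ℤ)) : Matrix (Fin 2) (Fin 2) ℤ)) 0 0 * (((g⁻¹ : SL(2, ℤ)) : Matrix (Fin 2) (Fin 2) ℤ) * M.adjugate * (((u⁻¹ : Gamma0 N) : SL(2, ℤ)) : Matrix (Fin 2) (Fin 2) ℤ) * ((γ : SL(2, ℤ)) : Matrix (Fin 2) (Fin 2) ℤ)) 1 0 ∨ ((((g⁻¹ : SL(2, ℤ)) : Matrix (Fin 2) (Fin 2) ℤ) * M.adjugate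 * (((u⁻¹ : Gamma0 N) : SL(2, ℤ)) : Matrix (Fin 2) (Fin 2) ℤ) * ((γ : SL(2, ℤ)) : Matrix (Fin 2) (Fin 2) ℤ)) 0 0 * (((g⁻¹ : SL(2, ℤ)) : Matrix (Fin 2) (Fin 2) ℤ) * M.adjugate * (((u⁻¹ : Gamma0 N) : SL(2, ℤ)) : Matrix (Fin 2) (Fin 2) ℤ) * ((γ : SL(2, ℤ)) : Matrix (Fin 2) (Fin 2) ℤ)) 1 0 = 0 ∧ (0 < ((((g⁻¹ : SL(2, ℤ)) : Matrix (Fin 2) (Fin 2) ℤ) * M.adjugate * (((u⁻¹ : Gamma0 N) : SL(2, ℤ)) : Matrix (Fin 2) (Fin 2) ℤ) * ((γ : SL(2, ℤ)) : Matrix (Fin 2) (Fin 2) ℤ)) 0 0 + 2 * (((g⁻¹ : SL(2, ℤ)) : Matrix (Fin 2) (Fin 2) ℤ) * M.adjugate * (((u⁻¹ : Gamma0 N) : SL(2, ℤ)) : Matrix (Fin 2) (Fin 2) ℤ) * ((γ : SL(2, ℤ)) : Matrix (Fin 2) (Fin 2) ℤ)) 0 1) * ((((g⁻¹ : SL(2,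 ℤ)) : Matrix (Fin 2) (Fin 2) ℤ) * M.adjugate * (((u⁻¹ : Gamma0 N) : SL(2, ℤ)) : Matrix (Fin 2) (Fin 2) ℤ) * ((γ : SL(2, ℤ)) : Matrix (Fin 2) (Fin 2) ℤ)) 1 0 + 2 * (((g⁻¹ : SL(2, ℤ)) : Matrix (Fin 2) (Fin 2) ℤ) * M.adjugate * (((u⁻¹ : Gamma0 N) : SL(2, ℤ)) : Matrix (Fin 2) (Fin 2) ℤ) * ((γ : SL(2, ℤ)) : Matrix (Fin 2) (Fin 2) ℤ)) 1 1) ∨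
          (((((g⁻¹ : SL(2, ℤ)) : Matrix (Fin 2) (Fin 2) ℤ) * M.adjugate * (((u⁻¹ : Gamma0 N) : SL(2, ℤ)) : Matrix (Fin 2) (Fin 2) ℤ) * ((γ : SL(2, ℤ)) : Matrix (Fin 2) (Fin 2) ℤ)) 0 0 + 2 * (((g⁻¹ : SL(2, ℤ)) : Matrix (Fin 2) (Fin 2) ℤ) * M.adjugate * (((u⁻¹ : Gamma0 N) : SL(2, ℤ)) : Matrix (Fin 2) (Fin 2) ℤ) * ((γ : SL(2, ℤ)) : Matrix (Fin 2) (Fin 2) ℤ)) 0 1) * ((((g⁻¹ : SL(2, ℤ)) : Matrix (Fin 2) (Fin 2) ℤ) * M.adjugate * (((u⁻¹ : Gamma0 N) : SL(2, ℤ)) : Matrix (Fin 2) (Fin 2) ℤ) * ((γ : SL(2, ℤ)) : Matrix (Fin 2) (Fin 2) ℤ)) 1 0 + 2 * (((g⁻¹ : SL(2, ℤ)) : Matrix (Fin 2) (Fin 2) ℤ) * M.adjugate * (((u⁻¹ : Gamma0 N) : SL(2, ℤ)) : Matrix (Fin 2) (Fin 2) ℤ) * ((γ : SL(2, ℤ))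 : Matrix (Fin 2) (Fin 2) ℤ)) 1 1) = 0 ∧ 0 < (((g⁻¹ : SL(2, ℤ)) : Matrix (Fin 2) (Fin 2) ℤ) * M.adjugate * (((u⁻¹ : Gamma0 N) : SL(2, ℤ)) : Matrix (Fin 2) (Fin 2) ℤ) * ((γ : SL(2, ℤ)) : Matrix (Fin 2) (Fin 2) ℤ)) 0 0 * (((g⁻¹ : SL(2, ℤ)) : Matrix (Fin 2) (Fin 2) ℤ) * M.adjugate * (((u⁻¹ : Gamma0 N) : SL(2, ℤ)) : Matrix (Fin 2) (Fin 2) ℤ) * ((γ : SL(2, ℤ)) : Matrix (Fin 2) (Fin 2) ℤ)) 1 1 + (((g⁻¹ : SL(2, ℤ)) : Matrix (Fin 2) (Fin 2) ℤ) * M.adjugate * (((u⁻¹ : Gamma0 N) : SL(2, ℤ)) : Matrix (Fin 2) (Fin 2) ℤ) * ((γ : SL(2, ℤ)) : Matrix (Fin 2) (Fin 2) ℤ)) 0 1 * (((g⁻¹ : SL(2, ℤ)) : Matrix (Fin 2) (Fin 2) ℤ) * M.adjugate * (((u⁻¹ : Gamma0 N) : SL(2, ℤ)) : Matrix (Fin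 2) (Fin 2) ℤ) * ((γ : SL(2, ℤ)) : Matrix (Fin 2) (Fin 2) ℤ)) 1 0)))) then (1 : ℤ) else 0) -
         (if (0 < (((g⁻¹ : SL(2, ℤ)) : Matrix (Fin 2) (Fin 2) ℤ) * M.adjugate * (((u⁻¹ : Gamma0 N) : SL(2, ℤ)) : Matrix (Fin 2) (Fin 2) ℤ)) 0 0 * (((g⁻¹ : SL(2, ℤ)) : Matrix (Fin 2) (Fin 2) ℤ) * M.adjugate * (((u⁻¹ : Gamma0 N) : SL(2, ℤ)) : Matrix (Fin 2) (Fin 2) ℤ)) 1 0 ∨ ((((g⁻¹ : SL(2, ℤ)) : Matrix (Fin 2) (Fin 2) ℤ) * M.adjugate * (((u⁻¹ : Gamma0 N) : SL(2, ℤ)) : Matrix (Fin 2) (Fin 2) ℤ)) 0 0 * (((g⁻¹ : SL(2, ℤ)) : Matrix (Fin 2) (Fin 2) ℤ) * M.adjugate * (((u⁻¹ : Gamma0 N) : SL(2, ℤ)) : Matrix (Fin 2) (Fin 2) ℤ)) 1 0 = 0 ∧ (0 < ((((g⁻¹ : SL(2, ℤ)) : Matrix (Fin 2) (Fin 2) ℤ)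 * M.adjugate * (((u⁻¹ : Gamma0 N) : SL(2, ℤ)) : Matrix (Fin 2) (Fin 2) ℤ)) 0 0 + 2 * (((g⁻¹ : SL(2, ℤ)) : Matrix (Fin 2) (Fin 2) ℤ) * M.adjugate * (((u⁻¹ : Gamma0 N) : SL(2, ℤ)) : Matrix (Fin 2) (Fin 2) ℤ)) 0 1) * ((((g⁻¹ : SL(2, ℤ)) : Matrix (Fin 2) (Fin 2) ℤ) * M.adjugate * (((u⁻¹ : Gamma0 N) : SL(2, ℤ)) : Matrix (Fin 2) (Fin 2) ℤ)) 1 0 + 2 * (((g⁻¹ : SL(2, ℤ)) : Matrix (Fin 2) (Fin 2) ℤ) * M.adjugate * (((u⁻¹ : Gamma0 N) : SL(2, ℤ)) : Matrix (Fin 2) (Fin 2) ℤ)) 1 1) ∨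
          (((((g⁻¹ : SL(2, ℤ)) : Matrix (Fin 2) (Fin 2) ℤ) * M.adjugate * (((u⁻¹ : Gamma0 N) : SL(2, ℤ)) : Matrix (Fin 2) (Fin 2) ℤ)) 0 0 + 2 * (((g⁻¹ : SL(2, ℤ)) : Matrix (Fin 2) (Fin 2) ℤ) * M.adjugate * (((u⁻¹ : Gamma0 N) : SL(2, ℤ)) : Matrix (Fin 2) (Fin 2) ℤ)) 0 1) * ((((g⁻¹ : SL(2, ℤ)) : Matrix (Fin 2) (Fin 2) ℤ) * M.adjugate * (((u⁻¹ : Gamma0 N) : SL(2, ℤ)) : Matrix (Fin 2) (Fin 2) ℤ)) 1 0 + 2 * (((g⁻¹ : SL(2, ℤ)) : Matrix (Fin 2) (Fin 2) ℤ) * M.adjugate * (((u⁻¹ : Gamma0 N) : SL(2, ℤ)) : Matrix (Fin 2) (Fin 2) ℤ)) 1 1) = 0 ∧ 0 < (((g⁻¹ : SL(2, ℤ)) : Matrix (Fin 2) (Fin 2) ℤ) * M.adjugate * (((u⁻¹ : Gamma0 N) : SL(2, ℤ)) : Matrix (Fin 2) (Fin 2) ℤ)) 0 0 * (((g⁻¹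 : SL(2, ℤ)) : Matrix (Fin 2) (Fin 2) ℤ) * M.adjugate * (((u⁻¹ : Gamma0 N) : SL(2, ℤ)) : Matrix (Fin 2) (Fin 2) ℤ)) 1 1 + (((g⁻¹ : SL(2, ℤ)) : Matrix (Fin 2) (Fin 2) ℤ) * M.adjugate * (((u⁻¹ : Gamma0 N) : SL(2, ℤ)) : Matrix (Fin 2) (Fin 2) ℤ)) 0 1 * (((g⁻¹ : SL(2, ℤ)) : Matrix (Fin 2) (Fin 2) ℤ) * M.adjugate * (((u⁻¹ : Gamma0 N) : SL(2, ℤ)) : Matrix (Fin 2) (Fin 2) ℤ)) 1 0)))) then (1 : ℤ) else 0))).Finite := by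
  obtain ⟨D, hD⟩ := exists_dualChain ((γ : SL(2, ℤ)))
  have hdetC : 0 < (M * ((g : SL(2, ℤ)) : Matrix (Fin 2) (Fin 2) ℤ) * ((S : SL(2, ℤ)) : Matrix (Fin 2) (Fin 2) ℤ)).det := by
    rw [Matrix.det_mul, Matrix.det_mul, Matrix.SpecialLinearGroup.det_coe, Matrix.SpecialLinearGroup.det_coe, mul_one, mul_one]; exact hM
  obtain ⟨g₀, u0, v0, w0, m, x, y, P, h₁, d, hu, -, hCeq, hm, hx0, hy0, hypos, hdetc, -, hd, hvd, hwd, hlen, hget, -, -, -, -, -⟩ :=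
    exists_reexpansion _ hdetC
  have hsupp := manin_block_support γ D hD g₀ u0 v0 w0 d m x y P hu hd hm hx0 hy0 hypos hdetc hvd hwd hlen hget
  rw [← hCeq] at hsupp
  have hadj : (M * ((g : SL(2, ℤ)) : Matrix (Fin 2) (Fin 2) ℤ) * ((S : SL(2, ℤ)) : Matrix (Fin 2) (Fin 2) ℤ)).adjugate =
      ((S⁻¹ : SL(2, ℤ)) : Matrix (Fin 2) (Fin 2) ℤ) * (((g⁻¹ : SL(2, ℤ)) : Matrix (Fin 2) (Fin 2) ℤ) * M.adjugate) := by
    rw [Matrix.adjugate_mul_distrib, Matrix.adjugate_mul_distrib, Matrix.SpecialLinearGroup.coe_inv, Matrix.SpecialLinearGroup.coe_inv]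
  have hdetM : M.adjugate.det ≠ 0 := by
    rw [Matrix.det_adjugate]; simp; exact hM.ne'
  refine hsupp.subset fun u hu' ↦ ?_
  rw [Function.mem_support] at hu' ⊢
  have hZ1 : (((g⁻¹ : SL(2, ℤ)) : Matrix (Fin 2) (Fin 2) ℤ) * M.adjugate * (((u⁻¹ : Gamma0 N) : SL(2, ℤ)) : Matrix (Fin 2) (Fin 2) ℤ) * ((γ : SL(2, ℤ)) : Matrix (Fin 2) (Fin 2) ℤ)).det ≠ 0 := by
    rw [Matrix.det_mul, Matrix.det_mul, Matrix.det_mul, Matrix.SpecialLinearGroup.det_coe, Matrix.SpecialLinearGroup.det_coe,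
      Matrix.SpecialLinearGroup.det_coe]; simpa using hdetM
  have hZ0 : (((g⁻¹ : SL(2, ℤ)) : Matrix (Fin 2) (Fin 2) ℤ) * M.adjugate * (((u⁻¹ : Gamma0 N) : SL(2, ℤ)) : Matrix (Fin 2) (Fin 2) ℤ)).det ≠ 0 := by
    rw [Matrix.det_mul, Matrix.det_mul, Matrix.SpecialLinearGroup.det_coe, Matrix.SpecialLinearGroup.det_coe]; simpa using hdetM
  have e1 : (M * ((g : SL(2, ℤ)) : Matrix (Fin 2) (Fin 2) ℤ) * ((S : SL(2, ℤ)) : Matrix (Fin 2) (Fin 2) ℤ)).adjugate * (((u⁻¹ : Gamma0 N) : SL(2, ℤ)) : Matrix (Fin 2) (Fin 2) ℤ) * ((γ : SL(2, ℤ)) : Matrix (Fin 2) (Fin 2) ℤ) =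
      ((S⁻¹ : SL(2, ℤ)) : Matrix (Fin 2) (Fin 2) ℤ) * (((g⁻¹ : SL(2, ℤ)) : Matrix (Fin 2) (Fin 2) ℤ) * M.adjugate * (((u⁻¹ : Gamma0 N) : SL(2, ℤ)) : Matrix (Fin 2) (Fin 2) ℤ) * ((γ : SL(2, ℤ)) : Matrix (Fin 2) (Fin 2) ℤ)) := by
    rw [hadj]; simp only [Matrix.mul_assoc]
  have e0 : (M * ((g : SL(2, ℤ)) : Matrix (Fin 2) (Fin 2) ℤ) * ((S : SL(2, ℤ)) : Matrix (Fin 2) (Fin 2) ℤ)).adjugate * (((u⁻¹ : Gamma0 N) : SL(2, ℤ)) : Matrix (Fin 2) (Fin 2) ℤ) =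
      ((S⁻¹ : SL(2, ℤ)) : Matrix (Fin 2) (Fin 2) ℤ) * (((g⁻¹ : SL(2, ℤ)) : Matrix (Fin 2) (Fin 2) ℤ) * M.adjugate * (((u⁻¹ : Gamma0 N) : SL(2, ℤ)) : Matrix (Fin 2) (Fin 2) ℤ)) := by
    rw [hadj]; simp only [Matrix.mul_assoc]
  rw [e1, e0, flagSide_Sinv_mul _ hZ1, flagSide_Sinv_mul _ hZ0]
  intro h0
  apply hu'
  linarith

end ManinSum

end Summit.BirchSwinnertonDyer.BirchSwinnertonDyer.Theorems.ThetaLayerLambdaCongruenceAtTwo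

end
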